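import Literature.NumberTheory.Automorphic.UnitaryGroupGenericity
import Literature.NumberTheory.Automorphic.ReductionTheoryGLnMinkowski
import HarnessLib

/-!
# The Borel pair `B = T · N` of the quasi-split unitary group `U(J_N)` (letters for the trace
# formula of the quasi-split group)

Topic `NumberTheory/Automorphic`; namespace `Literature.NumberTheory.Automorphic.UnitaryGroup`.
DEFINITIONS with bodies + proved structure lemmas; no named fact, no `sorry`, no instance, no
notation. For a commutative ring `R` with a ring endomorphism `σ` and the anti-diagonal standard form
`J_N = antidiag(1, …, 1)` (`StdForm.antidiagonal N`, Mok's `J_N`, Rogawski's `Φ`), the unitary group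
`G = U(σ, J_N)(R) = {g ∈ GL_N(R) : ᵗ(σg) J_N g = J_N}` (`unitaryGroupOfForm`) contains the
**standard Borel pair** cut out by the upper triangular Borel pair of `GL_N`:

* `borelOfForm σ N = G ∩ B_N` (upper triangular, `standardParabolicGL R id`),
* `torusOfForm σ N = G ∩ T_N` (diagonal, the range of `glDiagonal`),
* `unipotentOfForm σ N = G ∩ N_N` (upper unitriangular, `upperUnitriangular`).

Because `J_N` is anti-diagonal, `B_N`, `T_N`, `N_N` are stable under the involution
`g ↦ J_N ᵗ(σg)⁻¹ J_N` whose fixed points are `G`, so `G ∩ B_N` is a Borel subgroup of the quasi-split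
`G` with Levi decomposition `G ∩ B_N = (G ∩ N_N) ⋊ (G ∩ T_N)` (Rogawski (1990), §1.9–1.10: "`B` the
upper-triangular subgroup of `G`, `B = MN`, `M` the diagonal subgroup"; Mok (2014), §3.1). Proved:

* `mem_unitaryGroupOfForm_antidiagonal_iff_sum'` (ring version of the tree's field lemma):
  `g ∈ G ↔ ∑ᵢ σ(g_{ia}) g_{rev i, b} = δ_{b, rev a}`;
* `glDiagonal_mem_unitaryGroupOfForm_antidiagonal_iff`: **`diag(d) ∈ G ↔ σ(d_{rev i}) d_i = 1` for
  all `i`** (the maximal torus `M ≅ {(d_i) : d_{rev i} = σ(d_i)⁻¹}`, for `N = 3` Rogawski's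
  `d(a, b, ā⁻¹)`);
* `coe_inv_apply_of_mem_unitaryGroupOfForm_antidiagonal`: `(g⁻¹)_{ij} = σ(g_{rev j, rev i})`;
* **Levi decomposition** `exists_unipotent_mul_torus_of_mem_borelOfForm`: every `b ∈ G ∩ B_N` is
  `b = u · diag(d)` with `u ∈ G ∩ N_N`, `diag(d) ∈ G ∩ T_N`, `d_i = b_{ii}`; and
  `torusOfForm_inf_unipotentOfForm_eq_bot` (uniqueness);
* the adelic specialisation for Mok's datum `UnitaryGroup.quasiSplit F E c N`: `borelAdelic`,
  `torusAdelic` (the tree's `adelicUnipotent` is the third member), their rational points, the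
  membership criteria and the adelic Levi decomposition `exists_adelicUnipotent_mul_torusAdelic`.

Not here (next editions of the T1-qs letters): the modulus `δ_B` of `B(𝔸_F)` as Mathlib's
`modularCharacter` and its value `δ_B = δ_{B_{GL_N(𝔸_E)}}^{1/2}` on `T(𝔸_F)` (its unramified local
index is the tree's `relIndex_conjAct_borelInt_eq_pow_sum_unitary`), the Weyl element, heights and
truncation.

## References

* J. D. Rogawski, *Automorphic Representations of Unitary Groups in Three Variables*, Ann. of Math.
  Stud. 123 (1990), §1.9–§1.10 [Rogawski1990].
* C. P. Mok, *Endoscopic classification of representations of quasi-split unitary groups*, Mem. AMS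
  235 (2015), §1, §3.1 [Mok2014].
-/

noncomputable section

open Matrix
open scoped MatrixGroups

namespace Literature.NumberTheory.Automorphic

namespace UnitaryGroup

/-! ## §1 Over a commutative ring: entries for the anti-diagonal form -/

section Ring

variable {R : Type*} [CommRing R] (σ : R →+* R) (N : ℕ)

/-- Entries of `J_N` over `R`. [folklore] -/
private theorem antidiagonal_over_apply' (i j : Fin N) :
    (StdForm.antidiagonal N).over R i j = if j = Fin.rev i then (1 : R) else 0 := by
  simp only [StdForm.over, Matrix.map_apply, StdForm.antidiagonal_J_apply]
  split_ifs <;> simp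

/-- `(ᵗ(σA) J_N B)_{ab} = ∑ᵢ σ(A_{ia}) B_{rev i, b}`. [folklore] -/
private theorem map_transpose_mul_antidiagonal_mul_apply' (A B : Matrix (Fin N) (Fin N) R) (a b : Fin N) :
    ((A.map σ)ᵀ * (StdForm.antidiagonal N).over R * B) a b = ∑ i, σ (A i a) * B (Fin.rev i) b := by
  have inner : ∀ k : Fin N, ((A.map σ)ᵀ * (StdForm.antidiagonal N).over R) a k = σ (A (Fin.rev k) a) := by
    intro k
    rw [Matrix.mul_apply, Finset.sum_eq_single (Fin.rev k)]
    · rw [Matrix.transpose_apply, Matrix.map_apply, antidiagonal_over_apply',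
        if_pos (Fin.rev_rev k).symm, mul_one]
    · intro l _ hl
      rw [antidiagonal_over_apply', if_neg (fun h => hl (by rw [h, Fin.rev_rev])), mul_zero]
    · intro h; exact absurd (Finset.mem_univ _) h
  rw [Matrix.mul_apply]
  simp_rw [inner]
  rw [← Equiv.sum_comp Fin.revPerm]
  simp only [Fin.revPerm_apply, Fin.rev_rev]

/-- **Membership in `U(σ, J_N)` entrywise** (any commutative ring; the tree's
`HermitianLattice.mem_unitaryGroupOfForm_antidiagonal_iff_sum` is the field case):
`g ∈ U(σ, J_N) ↔ ∑ᵢ σ(g_{ia}) g_{rev i, b} = δ_{b, rev a}`. [cite: Rogawski1990, §1.9–§1.10] -/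
theorem mem_unitaryGroupOfForm_antidiagonal_iff_sum' (g : GL (Fin N) R) :
    g ∈ unitaryGroupOfForm σ ((StdForm.antidiagonal N).over R) ↔
      ∀ a b : Fin N, ∑ i, σ ((g : Matrix (Fin N) (Fin N) R) i a) *
          (g : Matrix (Fin N) (Fin N) R) (Fin.rev i) b = if b = Fin.rev a then 1 else 0 := by
  rw [mem_unitaryGroupOfForm_iff]
  constructor
  · intro h a b
    rw [← map_transpose_mul_antidiagonal_mul_apply', h, antidiagonal_over_apply']
  · intro h
    ext a b
    rw [map_transpose_mul_antidiagonal_mul_apply', h, antidiagonal_over_apply']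

/-- **The diagonal torus of `U(σ, J_N)`**: `diag(d₀, …, d_{N-1}) ∈ U(σ, J_N) ↔ σ(d_{rev i}) · d_i = 1`
for every `i` (for `N = 3`: `d = (a, b, σ(a)⁻¹)` with `b σ(b) = 1`, Rogawski's maximal torus `M`).
[cite: Rogawski1990, §1.9–§1.10] -/
theorem glDiagonal_mem_unitaryGroupOfForm_antidiagonal_iff (d : Fin N → Rˣ) :
    glDiagonal N R d ∈ unitaryGroupOfForm σ ((StdForm.antidiagonal N).over R) ↔
      ∀ i : Fin N, σ (d (Fin.rev i) : R) * (d i : R) = 1 := by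
  rw [mem_unitaryGroupOfForm_antidiagonal_iff_sum']
  have hsum : ∀ a b : Fin N, ∑ i, σ ((glDiagonal N R d : Matrix (Fin N) (Fin N) R) i a) *
      (glDiagonal N R d : Matrix (Fin N) (Fin N) R) (Fin.rev i) b =
      if b = Fin.rev a then σ (d a : R) * (d b : R) else 0 := by
    intro a b
    rw [coe_glDiagonal, Finset.sum_eq_single a]
    · rw [Matrix.diagonal_apply_eq, Matrix.diagonal_apply]
      by_cases hb : b = Fin.rev a
      · subst hb; simp
      · rw [if_neg (fun h => hb h.symm), if_neg hb, mul_zero]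
    · intro i _ hia
      rw [Matrix.diagonal_apply_ne _ hia, map_zero, zero_mul]
    · intro h; exact absurd (Finset.mem_univ _) h
  simp_rw [hsum]
  constructor
  · intro h i
    have := h (Fin.rev i) i
    rw [Fin.rev_rev, if_pos rfl, if_pos rfl] at this
    exact this
  · intro h a b
    by_cases hb : b = Fin.rev a
    · rw [if_pos hb, if_pos hb, hb]
      have := h (Fin.rev a)
      rwa [Fin.rev_rev] at this
    · rw [if_neg hb, if_neg hb]

/-- **`g⁻¹ = J_N ᵗ(σg) J_N` on `U(σ, J_N)`**: `(g⁻¹)_{ij} = σ(g_{rev j, rev i})` (any commutative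
ring). [cite: Rogawski1990, §1.9 p. 13] -/
theorem coe_inv_apply_of_mem_unitaryGroupOfForm_antidiagonal {g : GL (Fin N) R}
    (hg : g ∈ unitaryGroupOfForm σ ((StdForm.antidiagonal N).over R)) (i j : Fin N) :
    ((g⁻¹ : GL (Fin N) R) : Matrix (Fin N) (Fin N) R) i j =
      σ ((g : Matrix (Fin N) (Fin N) R) (Fin.rev j) (Fin.rev i)) := by
  set A : Matrix (Fin N) (Fin N) R := (g : Matrix (Fin N) (Fin N) R) with hA
  set J : Matrix (Fin N) (Fin N) R := (StdForm.antidiagonal N).over R with hJ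
  have hgJ : (A.map σ)ᵀ * J * A = J := hg
  -- `J ᵗ(σA) J` is a left inverse of `A`, hence the inverse of the unit `g`
  have hleft : (J * (A.map σ)ᵀ * J) * A = 1 := by
    rw [Matrix.mul_assoc, Matrix.mul_assoc, ← Matrix.mul_assoc (A.map σ)ᵀ, hgJ, hJ, StdForm.over_mul_over]
  have hinv : ((g⁻¹ : GL (Fin N) R) : Matrix (Fin N) (Fin N) R) = J * (A.map σ)ᵀ * J := by
    rw [Matrix.coe_units_inv, hA]
    exact Matrix.inv_eq_left_inv hleft
  rw [hinv, Matrix.mul_apply, Finset.sum_eq_single (Fin.rev j)]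
  · rw [hJ, antidiagonal_over_apply', if_pos (Fin.rev_rev j).symm, mul_one, Matrix.mul_apply,
      Finset.sum_eq_single (Fin.rev i)]
    · rw [antidiagonal_over_apply', if_pos rfl, one_mul, Matrix.transpose_apply, Matrix.map_apply]
    · intro l _ hl
      rw [antidiagonal_over_apply', if_neg (fun h => hl (by rw [h])), zero_mul]
    · intro h; exact absurd (Finset.mem_univ _) h
  · intro l _ hl
    rw [hJ, antidiagonal_over_apply', if_neg (fun h => hl (by rw [h, Fin.rev_rev])), mul_zero]
  · intro h; exact absurd (Finset.mem_univ _) h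

/-! ## §2 The Borel pair `B = T · N` of `U(σ, J_N)` -/

/-- **The standard Borel subgroup `B = U(σ, J_N) ∩ B_N`** of the quasi-split unitary group: the
upper triangular elements (Rogawski (1990), §1.9–1.10: "`B` the upper-triangular subgroup of `G`";
Mok (2014), §3.1: "the standard upper triangular Borel"). [cite: Rogawski1990, §1.9–§1.10] -/
def borelOfForm : Subgroup (GL (Fin N) R) :=
  unitaryGroupOfForm σ ((StdForm.antidiagonal N).over R) ⊓
    standardParabolicGL R (id : Fin N → Fin N)

/-- **The diagonal maximal torus `T = U(σ, J_N) ∩ T_N`** (Rogawski's `M`, the diagonal subgroup of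
`B`; Mok (2014), §3.1: "the standard diagonal maximal torus"). [cite: Rogawski1990, §1.9–§1.10] -/
def torusOfForm : Subgroup (GL (Fin N) R) :=
  unitaryGroupOfForm σ ((StdForm.antidiagonal N).over R) ⊓ (glDiagonal N R).range

/-- **The unipotent radical `N = U(σ, J_N) ∩ N_N`** of the standard Borel subgroup: the upper
unitriangular elements (Rogawski's `N = {u(x, z)}` for `N = 3`; the adelic specialisation is the
tree's `UnitaryGroup.adelicUnipotent`). [cite: Rogawski1990, §1.9–§1.10] -/
def unipotentOfForm : Subgroup (GL (Fin N) R) :=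
  unitaryGroupOfForm σ ((StdForm.antidiagonal N).over R) ⊓ upperUnitriangular (Fin N) R

variable {σ N}

/-- Membership in `B`. [cite: Rogawski1990, §1.9–§1.10] -/
theorem mem_borelOfForm_iff {g : GL (Fin N) R} :
    g ∈ borelOfForm σ N ↔ g ∈ unitaryGroupOfForm σ ((StdForm.antidiagonal N).over R) ∧
      (g : Matrix (Fin N) (Fin N) R).BlockTriangular id := Iff.rfl

/-- Membership in `T`: a unitary diagonal matrix, i.e. `diag(d)` with `σ(d_{rev i}) d_i = 1`.
[cite: Rogawski1990, §1.9–§1.10] -/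
theorem mem_torusOfForm_iff {g : GL (Fin N) R} :
    g ∈ torusOfForm σ N ↔ ∃ d : Fin N → Rˣ, (∀ i, σ (d (Fin.rev i) : R) * (d i : R) = 1) ∧
      glDiagonal N R d = g := by
  constructor
  · rintro ⟨hgU, d, rfl⟩
    exact ⟨d, (glDiagonal_mem_unitaryGroupOfForm_antidiagonal_iff σ N d).1 hgU, rfl⟩
  · rintro ⟨d, hd, rfl⟩
    exact ⟨(glDiagonal_mem_unitaryGroupOfForm_antidiagonal_iff σ N d).2 hd, d, rfl⟩

/-- Membership in `N`. [cite: Rogawski1990, §1.9–§1.10] -/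
theorem mem_unipotentOfForm_iff {g : GL (Fin N) R} :
    g ∈ unipotentOfForm σ N ↔ g ∈ unitaryGroupOfForm σ ((StdForm.antidiagonal N).over R) ∧
      g ∈ upperUnitriangular (Fin N) R := Iff.rfl

/-- `T ≤ B`. [cite: Rogawski1990, §1.9–§1.10] -/
theorem torusOfForm_le_borelOfForm : torusOfForm σ N ≤ borelOfForm σ N := by
  rintro g ⟨hgU, d, rfl⟩
  refine ⟨hgU, ?_⟩
  change (glDiagonal N R d : Matrix (Fin N) (Fin N) R).BlockTriangular id
  rw [coe_glDiagonal]
  exact Matrix.blockTriangular_diagonal _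

/-- `N ≤ B`. [cite: Rogawski1990, §1.9–§1.10] -/
theorem unipotentOfForm_le_borelOfForm : unipotentOfForm σ N ≤ borelOfForm σ N :=
  fun _ hg => ⟨hg.1, ((mem_upperUnitriangular_iff _).1 hg.2).1⟩

/-- `B ≤ U(σ, J_N)`. [cite: Rogawski1990, §1.9–§1.10] -/
theorem borelOfForm_le_unitaryGroupOfForm :
    borelOfForm σ N ≤ unitaryGroupOfForm σ ((StdForm.antidiagonal N).over R) := fun _ hg => hg.1

/-- **`T ∩ N = 1`** (a diagonal unitriangular matrix is `1`): the uniqueness half of the Levi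
decomposition. [cite: Rogawski1990, §1.9–§1.10] -/
theorem torusOfForm_inf_unipotentOfForm_eq_bot : torusOfForm σ N ⊓ unipotentOfForm σ N = ⊥ := by
  refine (Subgroup.eq_bot_iff_forall _).2 ?_
  rintro g ⟨⟨-, d, rfl⟩, -, hu⟩
  obtain ⟨-, hdiag⟩ := (mem_upperUnitriangular_iff _).1 hu
  refine Matrix.GeneralLinearGroup.ext fun i j => ?_
  rw [coe_glDiagonal, Units.val_one]
  by_cases hij : i = j
  · subst hij
    have := hdiag i
    rw [coe_glDiagonal, Matrix.diagonal_apply_eq] at this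
    rw [Matrix.diagonal_apply_eq, Matrix.one_apply_eq, this]
  · rw [Matrix.diagonal_apply_ne _ hij, Matrix.one_apply_ne hij]

/-- **Levi decomposition `B = N · T`**: an upper triangular `b ∈ U(σ, J_N)` factors as
`b = u · diag(d)` with `u ∈ N = U(σ, J_N) ∩ N_N` and `diag(d) ∈ T = U(σ, J_N) ∩ T_N`, where
`d_i = b_{ii}`. The diagonal part is unitary because `(b⁻¹)_{ii} = σ(b_{rev i, rev i})`
(`coe_inv_apply_of_mem_unitaryGroupOfForm_antidiagonal`) and `(b⁻¹)_{ii} = b_{ii}⁻¹` for a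
triangular `b`. (Rogawski (1990), §1.9–1.10: `B = MN`.) [cite: Rogawski1990, §1.9–§1.10] -/
theorem exists_unipotent_mul_torus_of_mem_borelOfForm {b : GL (Fin N) R} (hb : b ∈ borelOfForm σ N) :
    ∃ u ∈ unipotentOfForm σ N, ∃ d : Fin N → Rˣ, glDiagonal N R d ∈ torusOfForm σ N ∧
      (∀ i, (d i : R) = (b : Matrix (Fin N) (Fin N) R) i i) ∧ b = u * glDiagonal N R d := by
  obtain ⟨hbU, hbB⟩ := hb
  obtain ⟨u, hu, d, hd, hbud⟩ := exists_upperUnitriangular_mul_glDiagonal (n := N) (R := R) hbB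
  -- the diagonal part is unitary
  have hdU : glDiagonal N R d ∈ unitaryGroupOfForm σ ((StdForm.antidiagonal N).over R) := by
    rw [glDiagonal_mem_unitaryGroupOfForm_antidiagonal_iff]
    intro i
    -- `(b⁻¹)_{ii} = σ(b_{rev i, rev i}) = σ(d_{rev i})` and `(b⁻¹)_{ii} = d_i⁻¹`
    have h1 := coe_inv_apply_of_mem_unitaryGroupOfForm_antidiagonal σ N hbU i i
    rw [← hd (Fin.rev i)] at h1
    have huinv : u⁻¹ ∈ upperUnitriangular (Fin N) R := Subgroup.inv_mem _ hu
    obtain ⟨hut, hud⟩ := (mem_upperUnitriangular_iff _).1 huinv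
    have h2 : ((b⁻¹ : GL (Fin N) R) : Matrix (Fin N) (Fin N) R) i i = ((d i)⁻¹ : Rˣ) := by
      rw [hbud, _root_.mul_inv_rev, Units.val_mul, ← map_inv, coe_glDiagonal, Matrix.diagonal_mul, hud i,
        mul_one, Pi.inv_apply]
    rw [← h1, h2, Units.inv_mul]
  refine ⟨u, ⟨?_, hu⟩, d, ⟨hdU, d, rfl⟩, hd, hbud⟩
  -- `u = b · diag(d)⁻¹` is unitary
  have hu' : u = b * (glDiagonal N R d)⁻¹ := by rw [hbud, mul_inv_cancel_right]
  rw [hu']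
  exact Subgroup.mul_mem _ hbU (Subgroup.inv_mem _ hdU)

/-- Conversely `N · T ⊆ B`. [cite: Rogawski1990, §1.9–§1.10] -/
theorem mul_mem_borelOfForm {u t : GL (Fin N) R} (hu : u ∈ unipotentOfForm σ N)
    (ht : t ∈ torusOfForm σ N) : u * t ∈ borelOfForm σ N :=
  Subgroup.mul_mem _ (unipotentOfForm_le_borelOfForm hu) (torusOfForm_le_borelOfForm ht)

end Ring

/-! ## §3 The adelic Borel pair of Mok's `U_{E/F}(N)` -/

section Adelic

open NumberField IsDedekindDomain

variable (F E : Type) [Field F] [NumberField F] [Field E] [NumberField E] [Algebra F E]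
  (c : E ≃ₐ[F] E) (N : ℕ)

/-- The adelic form of `U_{E/F}(N)` is `J_N` over `𝔸_E`. [cite: Rogawski1990, §1.9–§1.10] -/
theorem adelicForm_antidiagonal :
    adelicForm E N ((StdForm.antidiagonal N).over E) =
      (StdForm.antidiagonal N).over (AdeleRing (𝓞 E) E) :=
  StdForm.over_map _ _

/-- **`B(𝔸_F)`**: the adelic points of the standard Borel subgroup of `U_{E/F}(N)` — the elements of
`U(J_N)(𝔸_F) ≤ GL_N(𝔸_E)` that are upper triangular (Mok (2014), §3.1). [cite: Mok2014, §3.1] -/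
def borelAdelic : Subgroup (quasiSplit F E c N).Adelic :=
  (standardParabolicGL (AdeleRing (𝓞 E) E) (id : Fin N → Fin N)).comap (adelicVal F E c N _)

/-- **`T(𝔸_F)`**: the adelic points of the diagonal maximal torus of `U_{E/F}(N)` (Mok (2014), §3.1).
[cite: Mok2014, §3.1] -/
def torusAdelic : Subgroup (quasiSplit F E c N).Adelic :=
  (glDiagonal N (AdeleRing (𝓞 E) E)).range.comap (adelicVal F E c N _)

/-- The rational points `B(F) ≤ B(𝔸_F)` (elements of the arithmetic subgroup). [cite: Rogawski1990, §1.9–§1.10] -/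
def rationalBorel : Subgroup (borelAdelic F E c N) :=
  ((quasiSplit F E c N).arithmeticSubgroup).comap (borelAdelic F E c N).subtype

/-- The rational points `T(F) ≤ T(𝔸_F)`. [cite: Rogawski1990, §1.9–§1.10] -/
def rationalTorus : Subgroup (torusAdelic F E c N) :=
  ((quasiSplit F E c N).arithmeticSubgroup).comap (torusAdelic F E c N).subtype

variable {F E c N}

/-- An adelic point of `U_{E/F}(N)` lies in `U(c ⊗ 1, J_N)(𝔸_E)` as a matrix. [cite: Rogawski1990, §1.9–§1.10] -/
theorem adelicVal_mem_unitaryGroupOfForm (g : (quasiSplit F E c N).Adelic) :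
    adelicVal F E c N _ g ∈
      unitaryGroupOfForm (conjAdele F E c) ((StdForm.antidiagonal N).over (AdeleRing (𝓞 E) E)) := by
  rw [← adelicForm_antidiagonal]
  exact g.2

/-- Membership in `B(𝔸_F)`: the adelic matrix is upper triangular. [cite: Rogawski1990, §1.9–§1.10] -/
theorem mem_borelAdelic_iff (g : (quasiSplit F E c N).Adelic) :
    g ∈ borelAdelic F E c N ↔
      ((adelicVal F E c N _ g : GL (Fin N) (AdeleRing (𝓞 E) E)) :
        Matrix (Fin N) (Fin N) (AdeleRing (𝓞 E) E)).BlockTriangular id := Iff.rfl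

/-- `B(𝔸_F)` is the generic Borel `borelOfForm` pulled back along the inclusion into `GL_N(𝔸_E)`.
[cite: Rogawski1990, §1.9–§1.10] -/
theorem mem_borelAdelic_iff_mem_borelOfForm (g : (quasiSplit F E c N).Adelic) :
    g ∈ borelAdelic F E c N ↔ adelicVal F E c N _ g ∈ borelOfForm (conjAdele F E c) N :=
  ⟨fun h => ⟨adelicVal_mem_unitaryGroupOfForm g, h⟩, fun h => h.2⟩

/-- **Membership in `T(𝔸_F)`**: `g = diag(d)` with `(c ⊗ 1)(d_{rev i}) · d_i = 1` for all `i`.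
[cite: Mok2014, §3.1] -/
theorem mem_torusAdelic_iff (g : (quasiSplit F E c N).Adelic) :
    g ∈ torusAdelic F E c N ↔ ∃ d : Fin N → (AdeleRing (𝓞 E) E)ˣ,
      (∀ i, conjAdele F E c (d (Fin.rev i) : AdeleRing (𝓞 E) E) * (d i : AdeleRing (𝓞 E) E) = 1) ∧
      glDiagonal N (AdeleRing (𝓞 E) E) d = adelicVal F E c N _ g := by
  constructor
  · rintro ⟨d, hd⟩
    refine ⟨d, ?_, hd⟩
    have h := adelicVal_mem_unitaryGroupOfForm g
    rw [← hd] at h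
    exact (glDiagonal_mem_unitaryGroupOfForm_antidiagonal_iff _ N d).1 h
  · rintro ⟨d, -, hd⟩
    exact ⟨d, hd⟩

/-- `N(𝔸_F)` is the generic unipotent radical pulled back (the tree's `adelicUnipotent`). [cite: Rogawski1990, §1.9–§1.10] -/
theorem mem_adelicUnipotent_iff_mem_unipotentOfForm (g : (quasiSplit F E c N).Adelic) :
    g ∈ adelicUnipotent F E c N ↔ adelicVal F E c N _ g ∈ unipotentOfForm (conjAdele F E c) N :=
  ⟨fun h => ⟨adelicVal_mem_unitaryGroupOfForm g, h⟩, fun h => h.2⟩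

/-- `T(𝔸_F) ≤ B(𝔸_F)`. [cite: Rogawski1990, §1.9–§1.10] -/
theorem torusAdelic_le_borelAdelic : torusAdelic F E c N ≤ borelAdelic F E c N := by
  rintro g ⟨d, hd⟩
  change ((adelicVal F E c N _ g : GL (Fin N) (AdeleRing (𝓞 E) E)) :
    Matrix (Fin N) (Fin N) (AdeleRing (𝓞 E) E)).BlockTriangular id
  rw [← hd, coe_glDiagonal]
  exact Matrix.blockTriangular_diagonal _

/-- `N(𝔸_F) ≤ B(𝔸_F)`. [cite: Rogawski1990, §1.9–§1.10] -/
theorem adelicUnipotent_le_borelAdelic : adelicUnipotent F E c N ≤ borelAdelic F E c N :=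
  fun g hg => ((mem_upperUnitriangular_iff _).1 ((mem_adelicUnipotent_iff g).1 hg)).1

/-- `T(𝔸_F) ∩ N(𝔸_F) = 1`. [cite: Rogawski1990, §1.9–§1.10] -/
theorem torusAdelic_inf_adelicUnipotent_eq_bot : torusAdelic F E c N ⊓ adelicUnipotent F E c N = ⊥ := by
  refine (Subgroup.eq_bot_iff_forall _).2 fun g hg => ?_
  have h : adelicVal F E c N _ g ∈ torusOfForm (conjAdele F E c) N ⊓ unipotentOfForm (conjAdele F E c) N :=
    ⟨⟨adelicVal_mem_unitaryGroupOfForm g, hg.1⟩, (mem_adelicUnipotent_iff_mem_unipotentOfForm g).1 hg.2⟩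
  rw [torusOfForm_inf_unipotentOfForm_eq_bot] at h
  exact adelicVal_injective F E c N _ (by rw [(Subgroup.mem_bot.1 h), map_one])

/-- **Adelic Levi decomposition `B(𝔸_F) = N(𝔸_F) · T(𝔸_F)`**: every `b ∈ B(𝔸_F)` is `b = u · t`
with `u ∈ N(𝔸_F)` and `t ∈ T(𝔸_F)` (Mok (2014), §3.1; Rogawski (1990), §1.9–1.10 `B = MN`).
[cite: Mok2014, §3.1] -/
theorem exists_adelicUnipotent_mul_torusAdelic {b : (quasiSplit F E c N).Adelic}
    (hb : b ∈ borelAdelic F E c N) :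
    ∃ u ∈ adelicUnipotent F E c N, ∃ t ∈ torusAdelic F E c N, b = u * t := by
  have hb' := (mem_borelAdelic_iff_mem_borelOfForm b).1 hb
  obtain ⟨u₀, hu₀, d, hdT, -, hbud⟩ := exists_unipotent_mul_torus_of_mem_borelOfForm hb'
  -- the two factors are adelic points of `U_{E/F}(N)`
  have htmem : glDiagonal N (AdeleRing (𝓞 E) E) d ∈ adelic F E c N ((StdForm.antidiagonal N).over E) := by
    change glDiagonal N (AdeleRing (𝓞 E) E) d ∈
      unitaryGroupOfForm (conjAdele F E c) (adelicForm E N ((StdForm.antidiagonal N).over E))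
    rw [adelicForm_antidiagonal]
    exact hdT.1
  have humem : u₀ ∈ adelic F E c N ((StdForm.antidiagonal N).over E) := by
    change u₀ ∈ unitaryGroupOfForm (conjAdele F E c) (adelicForm E N ((StdForm.antidiagonal N).over E))
    rw [adelicForm_antidiagonal]
    exact hu₀.1
  refine ⟨⟨u₀, humem⟩, hu₀.2, ⟨glDiagonal N (AdeleRing (𝓞 E) E) d, htmem⟩, ⟨d, rfl⟩, ?_⟩
  exact adelicVal_injective F E c N _ (by rw [map_mul]; exact hbud)

end Adelic

end UnitaryGroup

end Literature.NumberTheory.Automorphic
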